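import Summits.BirchSwinnertonDyer.Rank1Residual.ManinAdditive.ThetaBrandtDegreeLaws
import HarnessLib

/-!
# The θ-BRANDT degree law at `4 ∥ N` — §3: the additive Ribet–Takahashi EDGE and kernel sanity certificates
# (cell `bsd-f2-manin`, desc g17, MEMO-desc §35; T-desc-27; nothing asserted)

TYPER NOTE (typer g17).  §3 of HOME/desc/g17/Sketch-desc-g17.lean sha16 9025322b136025d5 VERBATIM (namespace folded to
`…ManinAdditive.ThetaBrandt`), split from `ThetaBrandtDegreeLaws.lean` for the 400-line cap.  THEOREMS only:
`padicValNat_modularDegree_eq_of_thetaBrandtDegreeLaw` (E-desc-117 ⇒ `ord_ℓ deg φ = ord_ℓ (12⟨m,m⟩)` for every prime `ℓ ≥ 5` —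
the additive Ribet–Takahashi statement, by unique factorisation), and the kernel checks `thetaExp_generators`, `stabWeight_five`,
`stabWeight_thirteen`, `g44_isThetaEquivariant`, `g44_hecke_three`, `g44_hecke_five`, `g44_height_and_eisenstein` (the 44a1 certificate,
`decide +kernel`).  BSD is not proved by this; C2/C3 OPEN.
-/

open scoped MatrixGroups ModularForm

open CongruenceSubgroup WeierstrassCurve Literature.NumberTheory.EllipticCurves.ModularForms

open Summit.BirchSwinnertonDyer.Rank1Residual.ManinAdditive.ConwayCut
open Summit.BirchSwinnertonDyer.Rank1Residual.ManinAdditive.RamanujanCut (HasRationalThreeTorsion)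
open Summit.BirchSwinnertonDyer.Rank1Residual.ManinAdditive.JumpDegree

noncomputable section
open Summit.BirchSwinnertonDyer.Rank1Residual.ManinAdditive.HurwitzBrandt

namespace Summit.BirchSwinnertonDyer.Rank1Residual.ManinAdditive.ThetaBrandt

/-! ### §3. Elementary edges and kernel sanity checks -/

/-- E-desc-117 ⇒ the prime-to-6 part of the modular degree of an `X₀(4p)`-optimal curve is the prime-to-6 part of its
θ-Brandt Gross height: `ord_ℓ deg φ = ord_ℓ (12⟨m,m⟩)` for every prime `ℓ ≥ 5` — the additive Ribet–Takahashi statement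
(proved from the defs by unique factorisation). -/
theorem padicValNat_modularDegree_eq_of_thetaBrandtDegreeLaw (h : ThetaBrandtDegreeLawAtFourPrime)
    {p : ℕ} (hp : p.Prime) (hp5 : 5 ≤ p)
    (W : WeierstrassCurve ℚ) [W.IsElliptic] [W.IsGloballyMinimal] [NeZero (W.conductorNorm ℤ)]
    (D : ModularParametrizationData W (W.conductorNorm ℤ)) (hN : W.conductorNorm ℤ = 4 * p)
    (hΛ : ∀ z ∈ D.L.lattice, ∃ w ∈ periodLattice D.f, z = D.c * w)
    (hmin : ∀ (W' : WeierstrassCurve ℚ) [W'.IsElliptic]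
        (D' : ModularParametrizationData W' (W.conductorNorm ℤ)),
        D'.f = D.f → D.modularDegree ≤ D'.modularDegree)
    (g : Fin (p + 1) → ZOmega) (hθ : IsThetaEquivariant p g) (hprim : IsPrimitive p g)
    (heig : IsThetaHeckeEigen p g (fun n => W.LFunction n))
    {ℓ : ℕ} (hℓ : ℓ.Prime) (hℓ2 : ℓ ≠ 2) (hℓ3 : ℓ ≠ 3) (hdeg : D.modularDegree ≠ 0)
    (hH : thetaHeightTwelve p g ≠ 0) :
    padicValNat ℓ D.modularDegree = padicValNat ℓ (thetaHeightTwelve p g).natAbs := by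
  classical
  have key := h p hp hp5 W D hN hΛ hmin g hθ hprim heig
  haveI : Fact ℓ.Prime := ⟨hℓ⟩
  generalize (if IsTypeFourStarAtTwoTame W ∧ HasRationalTwoTorsion W then 1 else 0) = A at key
  generalize (if IsThreeEisensteinDegenerateAtFour W then 1 else 0) = B at key
  generalize (if IsTypeFourStarAtTwoTame W ∧ ¬ HasRationalTwoTorsion W then 1 else 0) = C at key
  have hnat : 2 ^ (A + 2) * 3 ^ B * D.modularDegree = 2 ^ C * (thetaHeightTwelve p g).natAbs := by
    have e := congrArg Int.natAbs key
    simp only [Int.natAbs_mul, Int.natAbs_pow, Int.natAbs_natCast] at e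
    simpa using e
  have hndvd : ∀ m n : ℕ, ¬ ℓ ∣ 2 ^ m * 3 ^ n := by
    intro m n hd
    rcases (Nat.Prime.dvd_mul hℓ).mp hd with h | h
    · exact hℓ2 ((Nat.prime_dvd_prime_iff_eq hℓ Nat.prime_two).mp (hℓ.dvd_of_dvd_pow h))
    · exact hℓ3 ((Nat.prime_dvd_prime_iff_eq hℓ Nat.prime_three).mp (hℓ.dvd_of_dvd_pow h))
  have hC : ¬ ℓ ∣ 2 ^ C := by simpa using hndvd C 0
  have hHn : (thetaHeightTwelve p g).natAbs ≠ 0 := Int.natAbs_ne_zero.mpr hH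
  have e := congrArg (padicValNat ℓ) hnat
  rw [padicValNat.mul (by positivity) hdeg, padicValNat.mul (by positivity) hHn,
    padicValNat.eq_zero_of_not_dvd (hndvd (A + 2) B), padicValNat.eq_zero_of_not_dvd hC, zero_add, zero_add] at e
  exact e

/-- sanity (kernel): `θ̃` on generators — `θ̃(1) = θ̃(i) = θ̃(j) = θ̃(k) = 0`, `θ̃(ζ) = 1`, `θ̃(ζ²) = θ̃(−1−ζ) … = 2`
for `ζ = (−1+i+j+k)/2`, `ζ² = (−1−i−j−k)/2`. -/
theorem thetaExp_generators :
    thetaExp (2, 0, 0, 0) = 0 ∧ thetaExp (0, 2, 0, 0) = 0 ∧ thetaExp (0, 0, 2, 0) = 0 ∧ thetaExp (0, 0, 0, 2) = 0 ∧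
      thetaExp (-1, 1, 1, 1) = 1 ∧ thetaExp (-1, -1, -1, -1) = 2 := by
  decide

/-- sanity (kernel): at `p = 5` (`N = 20`) the six points of `ℙ¹(𝔽₅)` form ONE orbit with stabiliser of order 2
(`w = 2` everywhere: `12 ⟨m,m⟩ = 6 · 4 · 1 = 24`, `⟨m,m⟩ = 2`, and 20a1 — IV*, `E(ℚ)[2] ≠ 0`, degenerate, `deg φ = 1` — has
`2³ · 3 · 1 = 24 = 2⁰ · 24` as the law demands). -/
theorem stabWeight_five : (List.finRange 6).map (stabWeight 5) = [2, 2, 2, 2, 2, 2] := by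
  decide +kernel

/-- sanity (kernel): at `p = 13` (`N = 52`) the weights are `2` on one orbit of size 6 and `3` on two orbits of size 4 (off
the support): `#supp = 1 = dim S₂^{new}(Γ₀(52))`; at `p = 11` (`N = 44`) one free orbit (`w = 1`, `#supp = 1`); at `p = 7`
(`N = 28`) two `C₃`-orbits, empty support, no newforms. -/
theorem stabWeight_thirteen :
    (List.finRange 14).map (stabWeight 13) = [2, 2, 3, 3, 3, 2, 3, 3, 2, 3, 3, 3, 2, 2] ∧
      (List.finRange 12).map (stabWeight 11) = [1, 1, 1, 1, 1, 1, 1, 1, 1, 1, 1, 1] ∧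
      (List.finRange 8).map (stabWeight 7) = [3, 3, 3, 3, 3, 3, 3, 3] := by
  refine ⟨?_, ?_, ?_⟩ <;> decide +kernel

/-- THE EXPLICIT θ-BRANDT EIGENVECTOR OF 44a1 (`p = 11`, one free orbit): `g(u·x₀) = ω^{−θ̃(u)}`. -/
def g44 : Fin 12 → ZOmega :=
  ![(1, 0), (-1, -1), (-1, -1), (0, 1), (1, 0), (-1, -1), (0, 1), (0, 1), (1, 0), (0, 1), (-1, -1), (1, 0)]

/-- **Kernel certificate of the law's instance at `N = 44`** (four theorems; everything except the Cremona numbers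
`deg φ(44a1) = 2`, `(a₃, a₅)(44a1) = (1, −3)` is checked by the kernel): `g44` is θ-equivariant, is a `T₃`- and
`T₅`-eigenfunction with eigenvalues `24·1` and `24·(−3)`, has `12⟨m,m⟩ = 12`, and is Eisenstein mod `λ`; 44a1 is IV* at 2,
`E(ℚ)[2] = 0`, `E(ℚ)[3] ≠ 0`, `c₁₁ = 1`, `11 ≡ 2 (mod 3)` — degenerate, `t = 1` — and indeed `2^{0+2} · 3¹ · 2 = 24 = 2¹ · 12`
(E-desc-117) and `t = 1 ↔` Eisenstein (E-desc-118). -/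
theorem g44_isThetaEquivariant : IsThetaEquivariant 11 g44 := by
  unfold IsThetaEquivariant
  decide +kernel

/-- `T₂₄,₃ (W g44) = 24 · a₃(44a1) · W g44` with `a₃(44a1) = 1` (kernel). -/
theorem g44_hecke_three :
    ∀ x : Fin 12, thetaHecke24 11 3 (weightMul 11 g44) x =
      (24 * 1 * (weightMul 11 g44 x).1, 24 * 1 * (weightMul 11 g44 x).2) := by
  decide +kernel

/-- `T₂₄,₅ (W g44) = 24 · a₅(44a1) · W g44` with `a₅(44a1) = −3` (kernel). -/
theorem g44_hecke_five :
    ∀ x : Fin 12, thetaHecke24 11 5 (weightMul 11 g44) x =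
      (24 * (-3) * (weightMul 11 g44 x).1, 24 * (-3) * (weightMul 11 g44 x).2) := by
  decide +kernel

/-- `12⟨m,m⟩(44a1) = 12` and `W g44 ≡ 1 (mod λ)` everywhere (Eisenstein mod λ) (kernel). -/
theorem g44_height_and_eisenstein :
    thetaHeightTwelve 11 g44 = 12 ∧
      ∀ x : Fin 12, (3 : ℤ) ∣ (stabWeight 11 x : ℤ) * ((g44 x).1 + (g44 x).2) - 1 := by
  constructor <;> decide +kernel

end Summit.BirchSwinnertonDyer.Rank1Residual.ManinAdditive.ThetaBrandt
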